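import Summits.CriticalPhenomena.PercolationContinuityZ3.Theorems.PercNearOneGluingNoHeavyQuantAtomLaw
import HarnessLib

/-!
# QUANT lane R8, T-DEC: THE ATOM AS THE MIXTURE OF ITS TWO SEGMENTS, and **conv(atom, μ) is DEC as soon as the LIGHT segment's slice is**
# (census-2 g58: the kernel interface between the explicit residue `ConvClosedTAtoms` and census-1's light-slice programme LS)

builds on p205010 (kernel theorem, internal audit signed; external expert review pending)

Support file (`--supports stmt-CriticalPhenomena-4575`), QUANT lane seat prim-quant-census-2 (gen 58), rung R8 of
`run/shared/lean/prim/quant/LADDER.md`.  Theorems only, standard axioms, no sorries.  Memo `…/prim-quant-census-2-g58/EXTREME-ATOMS-G58.md` §3.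

* rate/gate bookkeeping for a segment into a mid `h ≤ j`: `gateOf_of_le`, `usage_eq_gateOf_div`, `gateOf_bounds` (`x² < γ < 1`),
  `gate_gt_of_usage_gt` / `gate_lt_of_usage_lt` (`c > u ⟹ γ > x`, `c < u ⟹ γ < x`), `credit_heavy_gateOf`, `credit_light_gateOf` (credit `≥ T` at the
  minimal gate in both readings).
* **`atomLaw_eq_mixture`**: `atomLaw x T j l₁ h₁ l₂ h₂ = w_E·TP[l₁,h₁;γ₁] + w_C·TP[l₂,h₂;γ₂]`, `γ_i = gateOf x T j l_i h_i`,
  `w_E = (1−x)(u−c₂)(1+c₁)/(c₁−c₂)`, `w_C = (1−x)(c₁−u)(1+c₂)/(c₁−c₂)`, `w_E + w_C = 1` (`atomWeights_sum`).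
* **`bdecAtT_heavySegment`**: the expensive segment is a datum without light straddlers (one heavy credit pair, `x < γ₁`).
* **`straddle_of_not_bdecAtT`**: under `¬ BDECAtT … a (atomLaw …)` the cheap segment is LIGHT (`γ₂ < x`) and STRADDLES (`j < h₂ + a`) — else the two
  segments form a B-datum.  (So in `ConvClosedTAtoms` both cheap segments are light straddlers, as in census-2 g56's residue census.)
* **`lconv_atomLaw_decAtT_of_lightSlice`** (+ mirror `lconv_decAtT_atomLaw_of_lightSlice`): for admissible data and a window-DEC probability law `μ₂`,
  `lconv (TP[l₂,h₂;γ₂]) μ₂ ∈ 𝒟(T₁+T₂, j) ⟹ lconv (atomLaw …) μ₂ ∈ 𝒟(T₁+T₂, j)` — mixture + one-sided theorem for the heavy segment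
  (`lconv_decAtT_of_bdecAtT_window'`) + `lconv_decAtT_of_mixtures`; = census-1 g21's top-datum architecture (`lconv_decAtT_of_window_pdecAtT`) for the explicit atom.
* **`lconv_atomLaw_atomLaw_decAtT_of_lightSlice`**: one atom pair is settled by the light slice of EITHER side — the binder of `ConvClosedTAtoms` pair by pair;
  the side selection (trivial side / ¬A2 / shorter light pair) and the light-slice cells are census-1's LS programme (CONV-RESIDUE-G21 §3–§8).

[this work]; nothing here is cited as a published result.  The gluing rows served [cite: KozmaNitzan2024, Conjecture 3 (p. 15)]; product
measure [cite: Grimmett1999, §1.3 p. 10].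
-/

noncomputable section

namespace Summit.CriticalPhenomena.PercolationContinuityZ3.Theorems

namespace Quant

open Finset

/-- the two-point law `{lo, hi; g}` (as in `…QuantLawDEC`) -/
local notation3 "TP[" lo ", " hi ", " g ", " h "]" =>
  (g : ℝ) * (if (h : ℕ) = (hi : ℕ) then (1 : ℝ) else 0) + (1 - (g : ℝ)) * (if (h : ℕ) = (lo : ℕ) then (1 : ℝ) else 0)

namespace LawDec

/-- indicator of equality of naturals, as a real number -/
local notation3 "𝟙[" a ", " b "]" => (if (a : ℕ) = (b : ℕ) then (1 : ℝ) else 0)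

/-! ### The atom as a mixture of its two segments -/

section LightSlice

variable (x T : ℝ) (j l₁ h₁ l₂ h₂ : ℕ)

/-- the gate of a segment into a mid `h ≤ j` is the minimal credit gate. -/
theorem gateOf_of_le (hh : h₁ ≤ j) : gateOf x T j l₁ h₁ = pairGate x T l₁ h₁ := by
  unfold gateOf; rw [if_neg (by omega)]

/-- `usage = gate/(1 − gate)`. -/
theorem usage_eq_gateOf_div : usage x T j l₁ h₁ = gateOf x T j l₁ h₁ / (1 - gateOf x T j l₁ h₁) := rfl

/-- the minimal credit gate of a compatible segment into a mid lies in `(x², 1)`. -/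
theorem gateOf_bounds (hx0 : 0 < x) (hx1 : x < 1) (hlow : 2 * (l₁ : ℝ) < T) (hh : h₁ ≤ j) (hc : T < (l₁ : ℝ) + h₁) :
    x ^ 2 < gateOf x T j l₁ h₁ ∧ gateOf x T j l₁ h₁ < 1 := by
  rw [gateOf_of_le x T j l₁ h₁ hh]
  refine ⟨?_, pairGate_lt_one x T l₁ h₁ hx0 hx1 hlow hc⟩
  have hlt : (l₁ : ℝ) < h₁ := by linarith
  have hρ : 0 < (T - 2 * (l₁ : ℝ)) / ((h₁ : ℝ) - l₁) := div_pos (by linarith) (by linarith)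
  unfold pairGate
  have : x ^ 2 < x ^ 2 + (1 - x) * ((T - 2 * (l₁ : ℝ)) / ((h₁ : ℝ) - l₁)) := by nlinarith
  exact lt_of_lt_of_le this (le_max_right _ _)

/-- **rate above the giant rate ⟺ gate above the floor**: `x/(1−x) < usage ⟹ x < gate` and `usage < x/(1−x) ⟹ gate < x`. -/
theorem gate_gt_of_usage_gt (hx1 : x < 1) (hg1 : gateOf x T j l₁ h₁ < 1) (hu : x / (1 - x) < usage x T j l₁ h₁) :
    x < gateOf x T j l₁ h₁ := by
  rw [usage_eq_gateOf_div] at hu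
  have h1 : 0 < 1 - gateOf x T j l₁ h₁ := by linarith
  have h2 : 0 < 1 - x := by linarith
  rw [div_lt_div_iff₀ h2 h1] at hu
  nlinarith

/-- `usage < x/(1−x) ⟹ gate < x` (cheap segments are light). -/
theorem gate_lt_of_usage_lt (hx1 : x < 1) (hg1 : gateOf x T j l₁ h₁ < 1) (hu : usage x T j l₁ h₁ < x / (1 - x)) :
    gateOf x T j l₁ h₁ < x := by
  rw [usage_eq_gateOf_div] at hu
  have h1 : 0 < 1 - gateOf x T j l₁ h₁ := by linarith
  have h2 : 0 < 1 - x := by linarith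
  rw [div_lt_div_iff₀ h1 h2] at hu
  nlinarith

/-- the credit of a segment at its minimal gate, heavy reading: `T ≤ 2l + (h − l)·gate`. -/
theorem credit_heavy_gateOf (hlow : 2 * (l₁ : ℝ) < T) (hh : h₁ ≤ j) (hc : T < (l₁ : ℝ) + h₁) :
    T ≤ 2 * (l₁ : ℝ) + ((h₁ : ℝ) - l₁) * gateOf x T j l₁ h₁ := by
  rw [gateOf_of_le x T j l₁ h₁ hh]
  have hd : (0 : ℝ) < (h₁ : ℝ) - l₁ := by linarith
  have hρ : (T - 2 * (l₁ : ℝ)) / ((h₁ : ℝ) - l₁) ≤ pairGate x T l₁ h₁ := le_max_left _ _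
  rw [div_le_iff₀ hd] at hρ
  linarith

/-- the credit of a segment at its minimal gate, light reading: `T ≤ 2l + (h − l)·(gate − x²)/(1 − x)`. -/
theorem credit_light_gateOf (hx1 : x < 1) (hlow : 2 * (l₁ : ℝ) < T) (hh : h₁ ≤ j) (hc : T < (l₁ : ℝ) + h₁) :
    T ≤ 2 * (l₁ : ℝ) + ((h₁ : ℝ) - l₁) * ((gateOf x T j l₁ h₁ - x ^ 2) / (1 - x)) := by
  rw [gateOf_of_le x T j l₁ h₁ hh]
  have hd : (0 : ℝ) < (h₁ : ℝ) - l₁ := by linarith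
  have h2 : 0 < 1 - x := by linarith
  have hρ : x ^ 2 + (1 - x) * ((T - 2 * (l₁ : ℝ)) / ((h₁ : ℝ) - l₁)) ≤ pairGate x T l₁ h₁ := le_max_right _ _
  have : (T - 2 * (l₁ : ℝ)) / ((h₁ : ℝ) - l₁) ≤ (pairGate x T l₁ h₁ - x ^ 2) / (1 - x) := by
    rw [le_div_iff₀ h2]; linarith
  rw [div_le_iff₀ hd] at this
  have e : (pairGate x T l₁ h₁ - x ^ 2) / (1 - x) * ((h₁ : ℝ) - l₁) = ((h₁ : ℝ) - l₁) * ((pairGate x T l₁ h₁ - x ^ 2) / (1 - x)) := by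
    ring
  linarith [e]

/-- **THE ATOM IS THE MIXTURE OF ITS TWO SEGMENTS AT THEIR MINIMAL GATES**: `atomLaw = w_E·TP[l₁,h₁;γ₁] + w_C·TP[l₂,h₂;γ₂]`, `γ_i = gateOf`,
`w_E = (1−x)(u−c₂)(1+c₁)/(c₁−c₂)`, `w_C = (1−x)(c₁−u)(1+c₂)/(c₁−c₂)`. [this work] -/
theorem atomLaw_eq_mixture (hx1 : x < 1) (hc : usage x T j l₁ h₁ ≠ usage x T j l₂ h₂)
    (hg₁ : gateOf x T j l₁ h₁ < 1) (hg₂ : gateOf x T j l₂ h₂ < 1) (b : ℕ) :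
    atomLaw x T j l₁ h₁ l₂ h₂ b =
      (1 - x) * (x / (1 - x) - usage x T j l₂ h₂) * (1 + usage x T j l₁ h₁) / (usage x T j l₁ h₁ - usage x T j l₂ h₂)
          * TP[l₁, h₁, gateOf x T j l₁ h₁, b]
        + (1 - x) * (usage x T j l₁ h₁ - x / (1 - x)) * (1 + usage x T j l₂ h₂) / (usage x T j l₁ h₁ - usage x T j l₂ h₂)
          * TP[l₂, h₂, gateOf x T j l₂ h₂, b] := by
  have h1 : (1 : ℝ) - gateOf x T j l₁ h₁ ≠ 0 := by linarith
  have h2 : (1 : ℝ) - gateOf x T j l₂ h₂ ≠ 0 := by linarith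
  have hx : (1 : ℝ) - x ≠ 0 := by linarith
  have hcc : usage x T j l₁ h₁ - usage x T j l₂ h₂ ≠ 0 := sub_ne_zero.2 hc
  -- `(1 + c)·γ = c` and `(1 + c)(1 − γ) = 1`
  have k₁ : (1 + usage x T j l₁ h₁) * gateOf x T j l₁ h₁ = usage x T j l₁ h₁ := by
    rw [usage_eq_gateOf_div]; field_simp; ring
  have k₁' : (1 + usage x T j l₁ h₁) * (1 - gateOf x T j l₁ h₁) = 1 := by
    rw [usage_eq_gateOf_div]; field_simp; ring
  have k₂ : (1 + usage x T j l₂ h₂) * gateOf x T j l₂ h₂ = usage x T j l₂ h₂ := by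
    rw [usage_eq_gateOf_div]; field_simp; ring
  have k₂' : (1 + usage x T j l₂ h₂) * (1 - gateOf x T j l₂ h₂) = 1 := by
    rw [usage_eq_gateOf_div]; field_simp; ring
  have e₁ : (1 + usage x T j l₁ h₁) * TP[l₁, h₁, gateOf x T j l₁ h₁, b] = 𝟙[b, l₁] + usage x T j l₁ h₁ * 𝟙[b, h₁] := by
    have : (1 + usage x T j l₁ h₁) * TP[l₁, h₁, gateOf x T j l₁ h₁, b]
        = ((1 + usage x T j l₁ h₁) * gateOf x T j l₁ h₁) * 𝟙[b, h₁] + ((1 + usage x T j l₁ h₁) * (1 - gateOf x T j l₁ h₁)) * 𝟙[b, l₁] := by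
      ring
    rw [this, k₁, k₁']; ring
  have e₂ : (1 + usage x T j l₂ h₂) * TP[l₂, h₂, gateOf x T j l₂ h₂, b] = 𝟙[b, l₂] + usage x T j l₂ h₂ * 𝟙[b, h₂] := by
    have : (1 + usage x T j l₂ h₂) * TP[l₂, h₂, gateOf x T j l₂ h₂, b]
        = ((1 + usage x T j l₂ h₂) * gateOf x T j l₂ h₂) * 𝟙[b, h₂] + ((1 + usage x T j l₂ h₂) * (1 - gateOf x T j l₂ h₂)) * 𝟙[b, l₂] := by
      ring
    rw [this, k₂, k₂']; ring
  have lhs : atomLaw x T j l₁ h₁ l₂ h₂ b = (1 - x) / (usage x T j l₁ h₁ - usage x T j l₂ h₂) *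
      ((x / (1 - x) - usage x T j l₂ h₂) * ((1 + usage x T j l₁ h₁) * TP[l₁, h₁, gateOf x T j l₁ h₁, b])
        + (usage x T j l₁ h₁ - x / (1 - x)) * ((1 + usage x T j l₂ h₂) * TP[l₂, h₂, gateOf x T j l₂ h₂, b])) := by
    rw [e₁, e₂]; rfl
  rw [lhs]
  field_simp

/-- the two mixture weights sum to one. [this work] -/
theorem atomWeights_sum (hx1 : x < 1) (hc : usage x T j l₁ h₁ ≠ usage x T j l₂ h₂) :
    (1 - x) * (x / (1 - x) - usage x T j l₂ h₂) * (1 + usage x T j l₁ h₁) / (usage x T j l₁ h₁ - usage x T j l₂ h₂)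
      + (1 - x) * (usage x T j l₁ h₁ - x / (1 - x)) * (1 + usage x T j l₂ h₂) / (usage x T j l₁ h₁ - usage x T j l₂ h₂) = 1 := by
  have hx : (1 : ℝ) - x ≠ 0 := by linarith
  have hcc : usage x T j l₁ h₁ - usage x T j l₂ h₂ ≠ 0 := sub_ne_zero.2 hc
  field_simp
  ring

end LightSlice

/-! ### The heavy segment and the light segment as data -/

/-- **the expensive segment of admissible data carries a datum WITHOUT light straddlers** (one heavy credit pair at its minimal gate). [this work] -/
theorem bdecAtT_heavySegment (x T : ℝ) (j M a l₁ h₁ l₂ h₂ : ℕ) (hx0 : 0 < x) (hx1 : x < 1) (hd : AtomData x T j M l₁ h₁ l₂ h₂) :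
    BDECAtT x T j M a (fun b => TP[l₁, h₁, gateOf x T j l₁ h₁, b]) := by
  obtain ⟨hl1, -⟩ := hd.lt_of
  obtain ⟨a1, a2, a3, a4, a5, -, -, -, -, -, -, -, c1⟩ := hd
  obtain ⟨hg0, hg1⟩ := gateOf_bounds x T j l₁ h₁ hx0 hx1 a2 a3 a5
  have hxg : x < gateOf x T j l₁ h₁ := gate_gt_of_usage_gt x T j l₁ h₁ hx1 hg1 c1
  refine ⟨Unit, inferInstance, fun _ => 1, fun _ => gateOf x T j l₁ h₁, fun _ => l₁, fun _ => h₁,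
    fun _ => zero_le_one, by simp, fun _ => ⟨by nlinarith, hg1.le⟩, fun _ => hl1.le, fun _ => a4, fun b => by simp, fun _ _ => ?_⟩
  exact Or.inl (Or.inr (Or.inr ⟨hl1, a3, hxg.le, credit_heavy_gateOf x T j l₁ h₁ a2 a3 a5⟩))

/-- **under `¬ BDECAtT` the cheap segment STRADDLES** (`j < h₂ + a`): otherwise the heavy segment and the light-below segment form a datum
without light straddlers.  (The cheap segment is light: `gateOf < x`, from `c₂ < x/(1−x)`.) [this work] -/
theorem straddle_of_not_bdecAtT (x T : ℝ) (j M a l₁ h₁ l₂ h₂ : ℕ) (hx0 : 0 < x) (hx1 : x < 1) (hd : AtomData x T j M l₁ h₁ l₂ h₂)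
    (hnb : ¬ BDECAtT x T j M a (atomLaw x T j l₁ h₁ l₂ h₂)) :
    j < h₂ + a ∧ gateOf x T j l₂ h₂ < x := by
  obtain ⟨hl1, hl2⟩ := hd.lt_of
  have hd' := hd
  obtain ⟨a1, a2, a3, a4, a5, b1, b2, b3, b4, b5, hne, c2, c1⟩ := hd'
  obtain ⟨hg0, hg1⟩ := gateOf_bounds x T j l₁ h₁ hx0 hx1 a2 a3 a5
  obtain ⟨hf0, hf1⟩ := gateOf_bounds x T j l₂ h₂ hx0 hx1 b2 b3 b5
  have hxg : x < gateOf x T j l₁ h₁ := gate_gt_of_usage_gt x T j l₁ h₁ hx1 hg1 c1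
  have hgx : gateOf x T j l₂ h₂ < x := gate_lt_of_usage_lt x T j l₂ h₂ hx1 hf1 c2
  refine ⟨?_, hgx⟩
  by_contra hle; push Not at hle
  apply hnb
  have hcc : usage x T j l₁ h₁ ≠ usage x T j l₂ h₂ := ne_of_gt (c2.trans c1)
  have hu₂ : 0 ≤ usage x T j l₂ h₂ := (usage_pos_of_compat x T j l₂ h₂ hx0 hx1 b2 hl2 (Or.inr b5)).le
  have h1x : 0 < 1 - x := by linarith
  -- the two-component datum
  refine ⟨Bool, inferInstance,
    fun r => if r then (1 - x) * (x / (1 - x) - usage x T j l₂ h₂) * (1 + usage x T j l₁ h₁) / (usage x T j l₁ h₁ - usage x T j l₂ h₂)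
      else (1 - x) * (usage x T j l₁ h₁ - x / (1 - x)) * (1 + usage x T j l₂ h₂) / (usage x T j l₁ h₁ - usage x T j l₂ h₂),
    fun r => if r then gateOf x T j l₁ h₁ else gateOf x T j l₂ h₂, fun r => if r then l₁ else l₂, fun r => if r then h₁ else h₂,
    fun r => ?_, ?_, fun r => ?_, fun r => ?_, fun r => ?_, fun b => ?_, fun r _ => ?_⟩
  · cases r
    · simp only [Bool.false_eq_true, if_false]
      exact div_nonneg (mul_nonneg (mul_nonneg h1x.le (by linarith)) (by linarith)) (by linarith)
    · simp only [if_true]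
      exact div_nonneg (mul_nonneg (mul_nonneg h1x.le (by linarith)) (by linarith [hu₂.trans_lt c2])) (by linarith)
  · rw [Fintype.sum_bool]; simp only [if_true, Bool.false_eq_true, if_false]
    exact atomWeights_sum x T j l₁ h₁ l₂ h₂ hx1 hcc
  · cases r
    · simp only [Bool.false_eq_true, if_false]; exact ⟨by nlinarith, hf1.le⟩
    · simp only [if_true]; exact ⟨by nlinarith, hg1.le⟩
  · cases r
    · simp only [Bool.false_eq_true, if_false]; exact hl2.le
    · simp only [if_true]; exact hl1.le
  · cases r
    · simp only [Bool.false_eq_true, if_false]; exact b4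
    · simp only [if_true]; exact a4
  · rw [Fintype.sum_bool]; simp only [if_true, Bool.false_eq_true, if_false]
    exact atomLaw_eq_mixture x T j l₁ h₁ l₂ h₂ hx1 hcc hg1 hf1 b
  · cases r
    · -- the cheap segment, light and below the layer after the shift: (LB)
      simp only [Bool.false_eq_true, if_false]
      exact Or.inr (Or.inr ⟨hl2, hle, hf0, hgx, credit_light_gateOf x T j l₂ h₂ hx1 b2 b3 b5⟩)
    · simp only [if_true]
      exact Or.inl (Or.inr (Or.inr ⟨hl1, a3, hxg.le, credit_heavy_gateOf x T j l₁ h₁ a2 a3 a5⟩))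

/-! ### The convolution of an atom from the light slice -/

/-- **AN ATOM CONVOLVES TO A DEC LAW AS SOON AS ITS LIGHT SLICE DOES.**  For admissible data on `{0..M₁}` and a window-DEC probability law `μ₂` on
`{0..M₂}` (window `[j − M₁, j]`): if the light segment's slice `lconv (TP[l₂,h₂;γ₂]) μ₂` is DEC at `(T₁ + T₂, j)`, then so is `lconv (atomLaw …) μ₂`
— the atom is the mixture of its two segments (`atomLaw_eq_mixture`), the heavy segment's slice is DEC by the one-sided theorem
(`lconv_decAtT_of_bdecAtT_window'` with `bdecAtT_heavySegment`), and DEC at a fixed target is convex (`lconv_decAtT_of_mixtures`).  This is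
census-1 g21's top-datum architecture (`lconv_decAtT_of_window_pdecAtT`) specialised to the explicit atom: `ConvClosedTAtoms` ⟸ the LIGHT-SLICE
statement LS on a selected side. [this work] -/
theorem lconv_atomLaw_decAtT_of_lightSlice (x T₁ T₂ : ℝ) (j M₁ M₂ l₁ h₁ l₂ h₂ : ℕ) (μ₂ : ℕ → ℝ) (hx0 : 0 < x) (hx1 : x < 1)
    (hd : AtomData x T₁ j M₁ l₁ h₁ l₂ h₂)
    (h20 : ∀ h, 0 ≤ μ₂ h) (h2M : ∀ h, M₂ < h → μ₂ h = 0) (h21 : ∑ h ∈ Finset.range (M₂ + 1), μ₂ h = 1)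
    (hwin : ∀ j'', j'' ≤ j → j ≤ j'' + M₁ → DECAtT x T₂ j'' M₂ μ₂)
    (hLS : DECAtT x (T₁ + T₂) j (M₁ + M₂) (lconv M₁ M₂ (fun b => TP[l₂, h₂, gateOf x T₁ j l₂ h₂, b]) μ₂)) :
    DECAtT x (T₁ + T₂) j (M₁ + M₂) (lconv M₁ M₂ (atomLaw x T₁ j l₁ h₁ l₂ h₂) μ₂) := by
  classical
  obtain ⟨hl1, hl2⟩ := hd.lt_of
  have hd' := hd
  obtain ⟨a1, a2, a3, a4, a5, b1, b2, b3, b4, b5, hne, c2, c1⟩ := hd'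
  obtain ⟨hg0, hg1⟩ := gateOf_bounds x T₁ j l₁ h₁ hx0 hx1 a2 a3 a5
  obtain ⟨hf0, hf1⟩ := gateOf_bounds x T₁ j l₂ h₂ hx0 hx1 b2 b3 b5
  have hcc : usage x T₁ j l₁ h₁ ≠ usage x T₁ j l₂ h₂ := ne_of_gt (c2.trans c1)
  have hu₂ : 0 ≤ usage x T₁ j l₂ h₂ := (usage_pos_of_compat x T₁ j l₂ h₂ hx0 hx1 b2 hl2 (Or.inr b5)).le
  have h1x : 0 < 1 - x := by linarith
  set wE := (1 - x) * (x / (1 - x) - usage x T₁ j l₂ h₂) * (1 + usage x T₁ j l₁ h₁) / (usage x T₁ j l₁ h₁ - usage x T₁ j l₂ h₂) with hwE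
  set wC := (1 - x) * (usage x T₁ j l₁ h₁ - x / (1 - x)) * (1 + usage x T₁ j l₂ h₂) / (usage x T₁ j l₁ h₁ - usage x T₁ j l₂ h₂) with hwC
  have hwE0 : 0 ≤ wE := div_nonneg (mul_nonneg (mul_nonneg h1x.le (by linarith)) (by linarith [hu₂.trans_lt c2])) (by linarith)
  have hwC0 : 0 ≤ wC := div_nonneg (mul_nonneg (mul_nonneg h1x.le (by linarith)) (by linarith)) (by linarith)
  have hws : wE + wC = 1 := atomWeights_sum x T₁ j l₁ h₁ l₂ h₂ hx1 hcc
  refine lconv_decAtT_of_mixtures x (T₁ + T₂) j (M₁ + M₂) M₁ M₂ (atomLaw x T₁ j l₁ h₁ l₂ h₂) μ₂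
    (fun r : Bool => if r then wE else wC)
    (fun r b => if r then TP[l₁, h₁, gateOf x T₁ j l₁ h₁, b] else TP[l₂, h₂, gateOf x T₁ j l₂ h₂, b])
    (fun _ : Unit => 1) (fun _ => μ₂) (fun r => ?_) ?_ (fun b => ?_) (fun _ => zero_le_one) (by simp) (fun b => by simp)
    (fun r _ _ _ => ?_)
  · cases r
    · simp only [Bool.false_eq_true, if_false]; exact hwC0
    · simp only [if_true]; exact hwE0
  · rw [Fintype.sum_bool]; simp only [if_true, Bool.false_eq_true, if_false]; exact hws
  · rw [Fintype.sum_bool]; simp only [if_true, Bool.false_eq_true, if_false]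
    rw [hwE, hwC]; exact atomLaw_eq_mixture x T₁ j l₁ h₁ l₂ h₂ hx1 hcc hg1 hf1 b
  · cases r
    · simp only [Bool.false_eq_true, if_false]; exact hLS
    · simp only [if_true]
      have hB := bdecAtT_heavySegment x T₁ j M₁ M₂ l₁ h₁ l₂ h₂ hx0 hx1 hd
      have hp0 : ∀ b, 0 ≤ TP[l₁, h₁, gateOf x T₁ j l₁ h₁, b] := fun b => by
        have : 0 ≤ gateOf x T₁ j l₁ h₁ := by nlinarith
        split_ifs <;> nlinarith
      exact lconv_decAtT_of_bdecAtT_window' x T₁ T₂ j M₁ M₂ _ μ₂ hx0 hx1 h20 h2M h21 hB hwin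

/-- **the mirror form**: the atom is the SECOND factor. [this work] -/
theorem lconv_decAtT_atomLaw_of_lightSlice (x T₁ T₂ : ℝ) (j M₁ M₂ l₁ h₁ l₂ h₂ : ℕ) (μ₁ : ℕ → ℝ) (hx0 : 0 < x) (hx1 : x < 1)
    (hd : AtomData x T₂ j M₂ l₁ h₁ l₂ h₂)
    (h10 : ∀ h, 0 ≤ μ₁ h) (h1M : ∀ h, M₁ < h → μ₁ h = 0) (h11 : ∑ h ∈ Finset.range (M₁ + 1), μ₁ h = 1)
    (hwin : ∀ j'', j'' ≤ j → j ≤ j'' + M₂ → DECAtT x T₁ j'' M₁ μ₁)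
    (hLS : DECAtT x (T₂ + T₁) j (M₂ + M₁) (lconv M₂ M₁ (fun b => TP[l₂, h₂, gateOf x T₂ j l₂ h₂, b]) μ₁)) :
    DECAtT x (T₁ + T₂) j (M₁ + M₂) (lconv M₁ M₂ μ₁ (atomLaw x T₂ j l₁ h₁ l₂ h₂)) := by
  have h := lconv_atomLaw_decAtT_of_lightSlice x T₂ T₁ j M₂ M₁ l₁ h₁ l₂ h₂ μ₁ hx0 hx1 hd h10 h1M h11 hwin hLS
  rw [add_comm T₂ T₁, add_comm M₂ M₁, ← lconv_comm] at h
  exact h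

/-- **ONE ATOM PAIR FROM A LIGHT SLICE ON EITHER SIDE**: for admissible data on both sides (the binder of `ConvClosedTAtoms`), if the light
slice of side 1 (`lconv (TP[l₁′,h₁′;γ]) (atomLaw₂)`) or of side 2 (`lconv (TP[l₂′,h₂′;γ]) (atomLaw₁)`, commuted frame) is DEC at the summed
target, then the convolution of the two atoms is.  (The selection rule — trivial side, else a ¬A2 side, tie-break the shorter light pair — and the
light-slice cells are census-1's LS programme, CONV-RESIDUE-G21 §3–§8; `ConvClosedTAtoms` follows from them pair by pair through this lemma.)
[this work] -/
theorem lconv_atomLaw_atomLaw_decAtT_of_lightSlice (x T₁ T₂ : ℝ) (M₁ M₂ j : ℕ) (l₁ h₁ l₁' h₁' l₂ h₂ l₂' h₂' : ℕ)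
    (hx0 : 0 < x) (hx1 : x < 1)
    (hd₁ : AtomData x T₁ j M₁ l₁ h₁ l₁' h₁') (hd₂ : AtomData x T₂ j M₂ l₂ h₂ l₂' h₂')
    (hw₁ : ∀ j'', j'' ≤ j → j ≤ j'' + M₂ → DECAtT x T₁ j'' M₁ (atomLaw x T₁ j l₁ h₁ l₁' h₁'))
    (hw₂ : ∀ j'', j'' ≤ j → j ≤ j'' + M₁ → DECAtT x T₂ j'' M₂ (atomLaw x T₂ j l₂ h₂ l₂' h₂'))
    (hLS : DECAtT x (T₁ + T₂) j (M₁ + M₂) (lconv M₁ M₂ (fun b => TP[l₁', h₁', gateOf x T₁ j l₁' h₁', b]) (atomLaw x T₂ j l₂ h₂ l₂' h₂')) ∨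
      DECAtT x (T₂ + T₁) j (M₂ + M₁) (lconv M₂ M₁ (fun b => TP[l₂', h₂', gateOf x T₂ j l₂' h₂', b]) (atomLaw x T₁ j l₁ h₁ l₁' h₁'))) :
    DECAtT x (T₁ + T₂) j (M₁ + M₂) (lconv M₁ M₂ (atomLaw x T₁ j l₁ h₁ l₁' h₁') (atomLaw x T₂ j l₂ h₂ l₂' h₂')) := by
  -- both atoms are probability laws on their supports
  have prob : ∀ (T : ℝ) (M l h l' h' : ℕ), AtomData x T j M l h l' h' →
      (∀ b, 0 ≤ atomLaw x T j l h l' h' b) ∧ (∀ b, M < b → atomLaw x T j l h l' h' b = 0) ∧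
      (∑ b ∈ Finset.range (M + 1), atomLaw x T j l h l' h' b = 1) := by
    intro T M l h l' h' hd
    obtain ⟨hl1, hl2⟩ := hd.lt_of
    obtain ⟨a1, a2, a3, a4, a5, b1, b2, b3, b4, b5, hne, c2, c1⟩ := hd
    have hc₂ : 0 ≤ usage x T j l' h' := (usage_pos_of_compat x T j l' h' hx0 hx1 b2 hl2 (Or.inr b5)).le
    have hcc : usage x T j l h ≠ usage x T j l' h' := ne_of_gt (c2.trans c1)
    exact ⟨atomLaw_nonneg x T j l h l' h' hx1 hc₂ c2 c1, fun b hb => atomLaw_eq_zero_of_gt x T j l h l' h' (by omega) a4 (by omega) b4 hb,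
      sum_range_atomLaw x T j l h l' h' hx1 hcc (by omega) a4 (by omega) b4⟩
  obtain ⟨n1, z1, s1⟩ := prob T₁ M₁ l₁ h₁ l₁' h₁' hd₁
  obtain ⟨n2, z2, s2⟩ := prob T₂ M₂ l₂ h₂ l₂' h₂' hd₂
  rcases hLS with hLS | hLS
  · exact lconv_atomLaw_decAtT_of_lightSlice x T₁ T₂ j M₁ M₂ l₁ h₁ l₁' h₁' _ hx0 hx1 hd₁ n2 z2 s2 hw₂ hLS
  · exact lconv_decAtT_atomLaw_of_lightSlice x T₁ T₂ j M₁ M₂ l₂ h₂ l₂' h₂' _ hx0 hx1 hd₂ n1 z1 s1 hw₁ hLS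

end LawDec

end Quant

end Summit.CriticalPhenomena.PercolationContinuityZ3.Theorems
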